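import Mathlib
import Summits.KontsevichZagierPeriods.Zeta5Search.CatalanRemarksVTIdentification
import Summits.KontsevichZagierPeriods.Zeta5Search.CatalanRemarksTPartialFractions
import HarnessLib

/-!
# Zudilin 2002 [Zu02c], Theorem 2, clause (i): the series `ũ_n G − ṽ_n = −Σ_{ν=1}^{∞} R̃_n′(ν)` (eq. (12))

Source: W. Zudilin, *A few remarks on linear forms involving Catalan's constant*, arXiv:math/0210423
[Zudilin2002CatalanRemarks], Sect. 2, Theorem 2, eq. (12).  HONEST FRAMING (cell `pub-zeta5`): systematic search;
no irrationality claim unless certified — this is the formalisation of the FIRST (analytic) clause of the named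
fact `Zudilin2003.remarksTheorem2`, in its exact shape
`∀ n ≥ 1, HasSum (fun ν : ℕ => −deriv (R̃_n) (ν+1)) (ũ_n·G − ṽ_n)` (`remarksTheorem2_series`,
`remarksTheorem2_clause_i`); nothing here is a statement about the arithmetic nature of Catalan's constant, and
the asymptotic clauses (ii)/(ii′) (Poincaré–Perron) are NOT addressed.

Proof: by `neg_deriv_RT` and `hasSum_tqTerm` (file `CatalanRemarksTPartialFractions`),
`−Σ_ν R̃_n′(ν) = Σ_i res_i·(π² − (−1)^{k_i}·8G + κ(k_i))` (a finite sum of convergent series); the three moments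
are `Σ_i res_i = 0` (`sum_lagT_eq_zero`: `deg Ñ_n = 2n−1 < 2n`), `−8Σ_i(−1)^{k_i}res_i = ũ_n` (`uT_eq_UresT`) and
`−Σ_i res_i κ(k_i) = ṽ_n` (`vT_eq_VresT`, `n ≥ 1`) — `sum_resRT_tqVal` — so the `π²` terms cancel and the sum is
`ũ_n G − ṽ_n = formT n`.  `remarksTheorem2_of_limits_of_inclusions` records the reduction of the named fact to
its clauses (ii), (ii′), (iii); clause (iii) is `CatalanRemarksVT.remarksTheorem2_inclusions`
(file `CatalanRemarksTInclusions`), combined in `CatalanRemarksTReduction`.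
-/

open Finset Filter Real Polynomial
open scoped Topology BigOperators

namespace Summit.KontsevichZagierPeriods.Zeta5Search.CatalanRemarksVT

open Literature.NumberTheory.Transcendental (catalanConstant hasSum_catalanConstant)
open Literature.NumberTheory.Irrationality.Zudilin2003
open Literature.NumberTheory.Irrationality.Zudilin2003.Remarks
open Literature.NumberTheory.Irrationality.KrattenthalerRivoal2008 (gbinom)

/-- **The three moment sums of the residues against `tqVal`**: `Σ_i res_i·(π² − (−1)^{k_i}8G + κ(k_i)) = ũ_n G − ṽ_n`
(`Σ res = 0` by `sum_lagT_eq_zero`, `−8Σ(−1)^k res = ũ_n` by `uT_eq_UresT`, `−Σ res·κ = ṽ_n` by `vT_eq_VresT`).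
[cite: Zudilin2002CatalanRemarks, Sect. 2, Theorem 2, eq. (12)] -/
theorem sum_resRT_tqVal (n : ℕ) (hn : 1 ≤ n) :
    ∑ i ∈ range (2 * n + 2), ((resRT n ((i : ℤ) - n) : ℚ) : ℝ) * tqVal ((i : ℤ) - n) = formT n := by
  have h0 : ∑ i ∈ range (2 * n + 2), resRT n ((i : ℤ) - n) = 0 := by
    rw [Finset.sum_congr rfl fun i hi => resRT_eq_muRT_lagT n i hn (mem_range.mp hi), ← Finset.mul_sum,
      sum_lagT_eq_zero n hn, mul_zero]
  have htopz : resRT n (((2 * n + 1 : ℕ) : ℤ) - n) = 0 := resRT_eq_zero_of_gt n _ (by push_cast; omega)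
  have h1 : ∑ i ∈ range (2 * n + 2), (-1 : ℚ) ^ ((i : ℤ) - n) * resRT n ((i : ℤ) - n) = -(uT n) / 8 := by
    rw [Finset.sum_range_succ, htopz, mul_zero, add_zero, uT_eq_UresT]
    unfold UresT wsum
    ring
  have h2 : ∑ i ∈ range (2 * n + 2), resRT n ((i : ℤ) - n) * kap ((i : ℤ) - n) = -(vT n) := by
    rw [Finset.sum_range_succ, htopz, zero_mul, add_zero, vT_eq_VresT n hn]
    unfold VresT wsum
    ring
  have h0R : ∑ i ∈ range (2 * n + 2), ((resRT n ((i : ℤ) - n) : ℚ) : ℝ) = 0 := by exact_mod_cast h0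
  have h1R : ∑ i ∈ range (2 * n + 2), (-1 : ℝ) ^ ((i : ℤ) - n) * ((resRT n ((i : ℤ) - n) : ℚ) : ℝ)
      = -(((uT n : ℚ) : ℝ)) / 8 := by
    have h := congrArg (fun q : ℚ => (q : ℝ)) h1
    push_cast at h
    exact h
  have h2R : ∑ i ∈ range (2 * n + 2), ((resRT n ((i : ℤ) - n) : ℚ) : ℝ) * ((kap ((i : ℤ) - n) : ℚ) : ℝ)
      = -(((vT n : ℚ) : ℝ)) := by exact_mod_cast h2
  have eF : ∀ i ∈ range (2 * n + 2), ((resRT n ((i : ℤ) - n) : ℚ) : ℝ) * tqVal ((i : ℤ) - n) =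
      ((resRT n ((i : ℤ) - n) : ℚ) : ℝ) * π ^ 2
        - 8 * catalanConstant * ((-1 : ℝ) ^ ((i : ℤ) - n) * ((resRT n ((i : ℤ) - n) : ℚ) : ℝ))
        + ((resRT n ((i : ℤ) - n) : ℚ) : ℝ) * ((kap ((i : ℤ) - n) : ℚ) : ℝ) := by
    intro i _; unfold tqVal; ring
  rw [Finset.sum_congr rfl eF, Finset.sum_add_distrib, Finset.sum_sub_distrib, ← Finset.sum_mul, ← Finset.mul_sum,
    h0R, h1R, h2R]
  unfold formT
  ring

/-- The summand of (12) seen through the partial fractions: `−R̃_n′(ν+1) = Σ_i res_i·16/(4ν+3−2k_i)²`.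
[cite: Zudilin2002CatalanRemarks, Sect. 2, eq. (12)] -/
theorem neg_deriv_RT_eq_sum_tqTerm (n : ℕ) (hn : 1 ≤ n) (ν : ℕ) :
    -deriv (fun t : ℝ => RT n t) ((ν : ℝ) + 1) =
      ∑ i ∈ range (2 * n + 2), ((resRT n ((i : ℤ) - n) : ℚ) : ℝ) * tqTerm ((i : ℤ) - n) ν := by
  rw [neg_deriv_RT n hn ν]
  refine Finset.sum_congr rfl fun i _ => ?_
  unfold tqTerm node
  push_cast
  rw [show (ν : ℝ) + 1 - (2 * (i : ℝ) - 2 * (n : ℝ) + 1) / 4 = (4 * (ν : ℝ) + 3 - 2 * ((i : ℝ) - n)) / 4 by ring]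
  rcases eq_or_ne (4 * (ν : ℝ) + 3 - 2 * ((i : ℝ) - n)) 0 with h | h
  · rw [h]; simp
  · field_simp
    ring

/-- **Clause (i) of Theorem 2 of [Zudilin2002CatalanRemarks]: the series (12)**
`ũ_n G − ṽ_n = −Σ_{ν=1}^{∞} R̃_n′(ν)` for every `n ≥ 1` — partial fractions of (12) over `ℝ`, term-wise
differentiation at the positive integers, the digamma-type values `Σ_{ν≥1}(ν−P_k)⁻² = π² − (−1)^k8G + κ(k)`
(from `ζ(2) = π²/6` and `G = Σ(−1)^m/(2m+1)²`), and the residue identifications `uT_eq_UresT`, `vT_eq_VresT`;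
the `π²` terms cancel because the residues sum to zero.
[cite: Zudilin2002CatalanRemarks, Sect. 2, Theorem 2, eq. (12)] -/
theorem remarksTheorem2_series (n : ℕ) (hn : 1 ≤ n) :
    HasSum (fun ν : ℕ => -deriv (fun t : ℝ => RT n t) ((ν : ℝ) + 1)) (formT n) := by
  have hs : HasSum (fun ν : ℕ => ∑ i ∈ range (2 * n + 2), ((resRT n ((i : ℤ) - n) : ℚ) : ℝ) * tqTerm ((i : ℤ) - n) ν)
      (∑ i ∈ range (2 * n + 2), ((resRT n ((i : ℤ) - n) : ℚ) : ℝ) * tqVal ((i : ℤ) - n)) :=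
    hasSum_sum fun i _ => (hasSum_tqTerm _).mul_left _
  rw [show (fun ν : ℕ => -deriv (fun t : ℝ => RT n t) ((ν : ℝ) + 1)) =
      fun ν : ℕ => ∑ i ∈ range (2 * n + 2), ((resRT n ((i : ℤ) - n) : ℚ) : ℝ) * tqTerm ((i : ℤ) - n) ν
      from funext (neg_deriv_RT_eq_sum_tqTerm n hn), ← sum_resRT_tqVal n hn]
  exact hs

/-- The first clause of the named fact `Zudilin2003.remarksTheorem2`, in its exact shape. [cite: Zudilin2002CatalanRemarks, Sect. 2, Theorem 2] -/
theorem remarksTheorem2_clause_i :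
    ∀ n : ℕ, 1 ≤ n → HasSum (fun ν : ℕ => -deriv (fun t : ℝ => RT n t) ((ν : ℝ) + 1)) (formT n) :=
  fun n hn => remarksTheorem2_series n hn

/-- **`remarksTheorem2` reduced to its asymptotic clauses (ii), (ii′) and the inclusions (iii)** (the latter are
`CatalanRemarksVT.remarksTheorem2_inclusions` of the companion file `CatalanRemarksTInclusions`).
[cite: Zudilin2002CatalanRemarks, Sect. 2, Theorem 2] -/
theorem remarksTheorem2_of_limits_of_inclusions
    (h₂ : Tendsto (fun n : ℕ => |formT n| ^ (1 / (n : ℝ))) atTop (𝓝 (((Real.sqrt 5 - 1) / 2) ^ 5)))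
    (h₃ : Tendsto (fun n : ℕ => ((uT n : ℚ) : ℝ) ^ (1 / (n : ℝ))) atTop (𝓝 (((1 + Real.sqrt 5) / 2) ^ 5)))
    (h₄ : ∃ e : ℕ → ℕ, Tendsto (fun n : ℕ => (e n : ℝ) / n) atTop (𝓝 0) ∧
      ∀ n : ℕ, (∃ z : ℤ, (z : ℚ) = 2 ^ (4 * n + e n) * uT n)
        ∧ (∃ z : ℤ, (z : ℚ) = 2 ^ (4 * n + e n) * (Nat.lcmUpto (2 * n - 1) : ℚ) ^ 2 * vT n)) :
    remarksTheorem2 :=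
  ⟨remarksTheorem2_clause_i, h₂, h₃, h₄⟩

/-- Sanity (`n = 1`): the three residues `res_{−1} = 5/16`, `res_0 = −3/8`, `res_1 = 1/16` of `R̃_1` sum to zero.
[cite: Zudilin2002CatalanRemarks, Sect. 2, eq. (12)] -/
example : resRT 1 (-1) = 5 / 16 ∧ resRT 1 0 = -3 / 8 ∧ resRT 1 1 = 1 / 16 := by
  refine ⟨?_, ?_, ?_⟩ <;> norm_num [resRT, invFac, xq, gbinom, Nat.factorial] <;>
    norm_num [show Int.toNat 2 = 2 from rfl, Nat.factorial]

end Summit.KontsevichZagierPeriods.Zeta5Search.CatalanRemarksVT
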